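import Summits.Ventures.HodgeRepro2.T5SU11CoefficientL2
import Summits.Ventures.HodgeRepro2.T5CoshIntegral

/-!
# `∫_{SU(1,1)} cosh(η/2)^{-3p} dμ_R = 2 / (3p - 2)` for every `p > 2/3`

The support map's P2′ integrates the matrix coefficient and its square against Rühl's measure:
`∫ cosh(η/2)^{-3p} dμ = 2/(3p - 2)` (`= 2` for `p = 1`, `= 1/2` for `p = 2`), the `L¹ ∩ L²`
statement.  In the disc picture `cosh(η/2)^{-2} = 1 - |g·0|²`, so the integrand is
`coeffPow p g = (1 - |g·0|²)^{3p/2}`.  Here, with the `lintegral` form of the fibration theorem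
(no integrability hypothesis), the Möbius-invariant disc integral in polar coordinates
(`Complex.lintegral_comp_polarCoord_symm`), the radial substitution of `T5RuhlRadial` and the
cosh-integral of `T5CoshIntegral`:  `coeffPow p` is `μ`-integrable for EVERY Haar measure `μ` of
`SU(1,1)` and every `p > 2/3`, and against `μ_R = π⁻¹ • ν` its integral is exactly `2/(3p - 2)`.

Blind lane: Mathlib + own prefix only; no sorry; axioms ⊆ {propext, Classical.choice, Quot.sound}.
-/

namespace Summit.Ventures.HodgeRepro2.T5SU11CoefficientPow

open MeasureTheory MeasureTheory.Measure Metric T5PoincareMeasure T5SU11Unimodular T5SU11Fibration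
  T5SU11FibrationHaar T5SU11FibrationCartan T5SU11CoefficientL2 T5HaarCircle
open scoped ENNReal NNReal Real

/-- The normalised coefficient `(1 - |g·0|²)^{3p/2} = cosh(η/2)^{-3p}` in the disc picture. -/
noncomputable def coeffPow (p : ℝ) (g : SU11) : ℝ := (1 - ‖orbit g‖ ^ 2) ^ (3 * p / 2)

/-- `coeffPow p` is continuous. -/
lemma continuous_coeffPow (p : ℝ) : Continuous (coeffPow p) := by
  unfold coeffPow
  have h : ∀ g : SU11, 0 < 1 - ‖orbit g‖ ^ 2 := by
    intro g
    have := mem_ball_zero_iff.mp (orbit_mem_ball g)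
    nlinarith [norm_nonneg (orbit g)]
  exact (continuous_const.sub (continuous_orbit.norm.pow 2)).rpow_const fun g => Or.inl (h g).ne'

/-- `coeffPow p ≥ 0`. -/
lemma coeffPow_nonneg (p : ℝ) (g : SU11) : 0 ≤ coeffPow p g := by
  unfold coeffPow
  have := mem_ball_zero_iff.mp (orbit_mem_ball g)
  have h : 0 ≤ 1 - ‖orbit g‖ ^ 2 := by nlinarith [norm_nonneg (orbit g)]
  positivity

/-- `coeffPow p (s(z) · rot u) = (1 - |z|²)^{3p/2}` on the disc. -/
lemma coeffPow_fib (p : ℝ) {z : ℂ} (hz : z ∈ ball 0 1) (u : Circle) :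
    coeffPow p (fib (z, u)) = (1 - ‖z‖ ^ 2) ^ (3 * p / 2) := by
  unfold coeffPow
  rw [orbit_fib hz u]

section lintegral

variable [MeasurableSpace Circle] [BorelSpace Circle] (μC : Measure Circle) [IsHaarMeasure μC]

/-- **The `lintegral` form of the fibration formula** (no integrability hypothesis):
`∫⁻ f dν = ∫⁻_𝔻 (1 - |z|²)⁻² · ∫⁻_K f (s(z) k) dk dA(z)`. -/
theorem lintegral_nu (f : SU11 → ℝ≥0∞) (hf : Measurable f) :
    ∫⁻ g, f g ∂(nu μC) = ∫⁻ z in ball 0 1, ENNReal.ofReal (dens z) * ∫⁻ u, f (sec z * rot u) ∂μC := by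
  rw [nu, lintegral_map hf measurable_fib,
    lintegral_prod (fun p => f (fib p)) (hf.comp measurable_fib).aemeasurable]
  unfold poincare
  rw [lintegral_withDensity_eq_lintegral_mul _ measurable_dens.ennreal_ofReal
    (Measurable.lintegral_prod_right'
      (show Measurable fun p : ℂ × Circle => f (fib p) from hf.comp measurable_fib))]
  rfl

end lintegral

/-! ### The disc integral `∫_𝔻 (1 - |z|²)^{s} dA` in polar coordinates -/

/-- The radial integrand `r (1 - r²)^{s}` with `s = 3p/2 - 2` is the `T5RuhlRadial` integrand
`(r / (1 - r²)²) • (1 - r²)^{3p/2}`. -/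
lemma radial_integrand_eq (p r : ℝ) (hr : r ∈ Set.Ioo (0 : ℝ) 1) :
    (r / (1 - r ^ 2) ^ 2) • (1 - r ^ 2) ^ (3 * p / 2) = r * (1 - r ^ 2) ^ (3 * p / 2 - 2) := by
  have h1 : 0 < 1 - r ^ 2 := by nlinarith [hr.1, hr.2]
  rw [smul_eq_mul, Real.rpow_sub h1, Real.rpow_two]
  field_simp

/-- `1 - tanh(η/2)² = cosh(η/2)⁻²`, raised to `3p/2`: `cosh(η/2)^{-3p}`. -/
lemma one_sub_tanh_sq_rpow (p η : ℝ) :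
    (1 - Real.tanh (η / 2) ^ 2) ^ (3 * p / 2) = Real.cosh (1 / 2 * η) ^ (-(3 * p)) := by
  rw [T5CartanCoordinates.one_sub_tanh_sq, show η / 2 = 1 / 2 * η by ring, one_div,
    Real.inv_rpow (by positivity), ← Real.rpow_natCast, ← Real.rpow_mul (Real.cosh_pos _).le,
    ← Real.rpow_neg (Real.cosh_pos _).le]
  congr 1
  push_cast
  ring

/-- **The radial integral**: `∫_0^1 r (1 - r²)^{3p/2 - 2} dr = 1 / (3p - 2)` for `p > 2/3`
(`T5RuhlRadial.integral_Ioo_eq_integral_eta` + `T5CoshIntegral.ruhl_measure_integral`). -/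
theorem integral_radial (p : ℝ) (hp : 2 / 3 < p) :
    ∫ r in Set.Ioo (0 : ℝ) 1, r * (1 - r ^ 2) ^ (3 * p / 2 - 2) = 1 / (3 * p - 2) := by
  have h := T5RuhlRadial.integral_Ioo_eq_integral_eta (fun r => (1 - r ^ 2) ^ (3 * p / 2))
  rw [setIntegral_congr_fun measurableSet_Ioo (fun r hr => radial_integrand_eq p r hr)] at h
  rw [h]
  have h2 : ∀ η ∈ Set.Ioi (0 : ℝ), (Real.sinh η / 4) • (1 - Real.tanh (η / 2) ^ 2) ^ (3 * p / 2) =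
      (1 / 2) * (1 / 2 * Real.sinh η * Real.cosh (1 / 2 * η) ^ (-(3 * p))) := by
    intro η _
    rw [one_sub_tanh_sq_rpow, smul_eq_mul]
    ring
  rw [setIntegral_congr_fun measurableSet_Ioi h2, integral_const_mul,
    T5CoshIntegral.ruhl_measure_integral p hp]
  have h3 : (3 * p - 2) ≠ 0 := by linarith
  field_simp

/-- The radial integrand is integrable on `(0, 1)` for `p > 2/3`: it is non-negative and its
integral is the finite number above — but integrability needs a direct argument: the integrand is
bounded by `(1 - r)^{3p/2 - 2}` on `(0, 1)` (for `3p/2 - 2 ≤ 0`) or by `1` (otherwise). -/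
theorem integrableOn_radial (p : ℝ) (hp : 2 / 3 < p) :
    IntegrableOn (fun r : ℝ => r * (1 - r ^ 2) ^ (3 * p / 2 - 2)) (Set.Ioo (0 : ℝ) 1) := by
  set s : ℝ := 3 * p / 2 - 2 with hs
  have hs1 : -1 < s := by rw [hs]; linarith
  -- the comparison function `(1 - r)^s`, integrable on `(0, 1)`
  have hint : IntegrableOn (fun r : ℝ => (1 - r) ^ s) (Set.Ioo (0 : ℝ) 1) := by
    have h := (intervalIntegral.intervalIntegrable_rpow' hs1 (a := (0 : ℝ)) (b := 1))
    have h' : IntervalIntegrable (fun r : ℝ => (1 - r) ^ s) volume 0 1 := by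
      have := h.comp_sub_left 1
      simpa using this.symm
    exact (h'.def').mono_set (by rw [Set.uIoc_of_le zero_le_one]; exact Set.Ioo_subset_Ioc_self)
  have hmeas : AEStronglyMeasurable (fun r : ℝ => r * (1 - r ^ 2) ^ s)
      (volume.restrict (Set.Ioo (0 : ℝ) 1)) :=
    (measurable_id.mul ((measurable_const.sub (measurable_id.pow_const 2)).pow_const s)).aestronglyMeasurable
  rcases le_or_gt s 0 with hsle | hspos
  · -- `r (1 - r²)^s ≤ (1 - r)^s` for `s ≤ 0`
    refine hint.mono' hmeas ?_
    filter_upwards [ae_restrict_mem measurableSet_Ioo] with r hr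
    have h0 : 0 < 1 - r := by linarith [hr.2]
    have h1 : 0 < 1 + r := by linarith [hr.1]
    have h2 : 1 - r ^ 2 = (1 - r) * (1 + r) := by ring
    have hnn : 0 ≤ 1 - r ^ 2 := by nlinarith [hr.1, hr.2]
    rw [Real.norm_eq_abs, abs_of_nonneg (mul_nonneg hr.1.le (Real.rpow_nonneg hnn _)), h2,
      Real.mul_rpow h0.le h1.le]
    calc r * ((1 - r) ^ s * (1 + r) ^ s) ≤ 1 * ((1 - r) ^ s * 1) := by
          gcongr
          · exact hr.2.le
          · exact Real.rpow_le_one_of_one_le_of_nonpos (by linarith [hr.1]) hsle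
      _ = (1 - r) ^ s := by ring
  · -- `r (1 - r²)^s ≤ 1` for `s > 0`
    have hb : IntegrableOn (fun _ : ℝ => (1 : ℝ)) (Set.Ioo (0 : ℝ) 1) :=
      integrableOn_const (by simp)
    refine hb.mono' hmeas ?_
    filter_upwards [ae_restrict_mem measurableSet_Ioo] with r hr
    have h1 : 0 ≤ 1 - r ^ 2 := by nlinarith [hr.1, hr.2]
    have h3 : 1 - r ^ 2 ≤ 1 := by nlinarith [hr.1]
    rw [Real.norm_eq_abs, abs_of_nonneg (mul_nonneg hr.1.le (Real.rpow_nonneg h1 _))]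
    calc r * (1 - r ^ 2) ^ s ≤ 1 * 1 := by
          gcongr
          · exact hr.2.le
          · exact Real.rpow_le_one h1 h3 hspos.le
      _ = 1 := one_mul 1

/-- The disc integrand `(1 - |z|²)^{3p/2 - 2}` is non-negative. -/
lemma disc_integrand_nonneg (p : ℝ) (z : ℂ) (hz : z ∈ ball (0 : ℂ) 1) :
    0 ≤ (1 - ‖z‖ ^ 2) ^ (3 * p / 2 - 2) := by
  have := mem_ball_zero_iff.mp hz
  exact Real.rpow_nonneg (by nlinarith [norm_nonneg z]) _

/-- **The disc integral in polar coordinates**: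
`∫⁻_𝔻 (1 - |z|²)^{3p/2 - 2} dA = 2π / (3p - 2)` for `p > 2/3`
(`Complex.lintegral_comp_polarCoord_symm` + `integral_radial`). -/
theorem lintegral_ball_rpow (p : ℝ) (hp : 2 / 3 < p) :
    ∫⁻ z in ball (0 : ℂ) 1, ENNReal.ofReal ((1 - ‖z‖ ^ 2) ^ (3 * p / 2 - 2)) =
      ENNReal.ofReal (2 * π / (3 * p - 2)) := by
  set s : ℝ := 3 * p / 2 - 2 with hs
  set F : ℂ → ℝ≥0∞ := (ball (0 : ℂ) 1).indicator fun z => ENNReal.ofReal ((1 - ‖z‖ ^ 2) ^ s) with hF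
  have key := Complex.lintegral_comp_polarCoord_symm F
  rw [hF, lintegral_indicator measurableSet_ball] at key
  rw [← key, polarCoord_target]
  -- the integrand on the polar target
  have e : ∀ q ∈ Set.Ioi (0 : ℝ) ×ˢ Set.Ioo (-π) π,
      ENNReal.ofReal q.1 • (ball (0 : ℂ) 1).indicator (fun z => ENNReal.ofReal ((1 - ‖z‖ ^ 2) ^ s))
        (Complex.polarCoord.symm q) =
      (Set.Ioo (0 : ℝ) 1).indicator (fun r => ENNReal.ofReal (r * (1 - r ^ 2) ^ s)) q.1 * 1 := by
    rintro ⟨r, θ⟩ ⟨hr, _⟩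
    simp only [Set.mem_Ioi] at hr
    have hn : ‖Complex.polarCoord.symm (r, θ)‖ = r := by
      rw [Complex.norm_polarCoord_symm, abs_of_pos hr]
    by_cases h1 : r < 1
    · have hmem : Complex.polarCoord.symm (r, θ) ∈ ball (0 : ℂ) 1 := by
        rw [mem_ball_zero_iff, hn]; exact h1
      rw [Set.indicator_of_mem hmem, Set.indicator_of_mem (show r ∈ Set.Ioo (0 : ℝ) 1 from ⟨hr, h1⟩),
        mul_one, hn, smul_eq_mul, ← ENNReal.ofReal_mul hr.le]
    · have hmem : Complex.polarCoord.symm (r, θ) ∉ ball (0 : ℂ) 1 := by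
        rw [mem_ball_zero_iff, hn]; exact h1
      rw [Set.indicator_of_notMem hmem,
        Set.indicator_of_notMem (show r ∉ Set.Ioo (0 : ℝ) 1 from fun h => h1 h.2), smul_zero,
        zero_mul]
  rw [setLIntegral_congr_fun (measurableSet_Ioi.prod measurableSet_Ioo) e, Measure.volume_eq_prod,
    ← Measure.prod_restrict]
  set G : ℝ → ℝ≥0∞ := (Set.Ioo (0 : ℝ) 1).indicator fun r => ENNReal.ofReal (r * (1 - r ^ 2) ^ s)
    with hG
  have hGm : Measurable G := by
    rw [hG]
    exact (measurable_id.mul ((measurable_const.sub (measurable_id.pow_const 2)).pow_const s))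
      |>.ennreal_ofReal.indicator measurableSet_Ioo
  have h2 : ∫⁻ x : ℝ × ℝ, G x.1 * 1 ∂((volume.restrict (Set.Ioi (0 : ℝ))).prod
      (volume.restrict (Set.Ioo (-π) π))) =
      ∫⁻ x : ℝ × ℝ, G x.1 * (fun _ : ℝ => (1 : ℝ≥0∞)) x.2 ∂((volume.restrict (Set.Ioi (0 : ℝ))).prod
      (volume.restrict (Set.Ioo (-π) π))) := rfl
  rw [h2, lintegral_prod_mul hGm.aemeasurable measurable_const.aemeasurable, lintegral_one,
    Measure.restrict_apply_univ, Real.volume_Ioo, hG, lintegral_indicator measurableSet_Ioo,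
    Measure.restrict_restrict measurableSet_Ioo,
    Set.inter_eq_left.mpr (Set.Ioo_subset_Ioi_self : Set.Ioo (0 : ℝ) 1 ⊆ Set.Ioi 0),
    ← ofReal_integral_eq_lintegral_ofReal (integrableOn_radial p hp) ?_, integral_radial p hp,
    ← ENNReal.ofReal_mul (by have : 0 < 3 * p - 2 := by linarith
                             positivity)]
  · congr 1
    have h3 : (3 * p - 2) ≠ 0 := by linarith
    field_simp
    ring
  · filter_upwards [ae_restrict_mem measurableSet_Ioo] with r hr
    have h1 : 0 ≤ 1 - r ^ 2 := by nlinarith [hr.1, hr.2]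
    exact mul_nonneg hr.1.le (Real.rpow_nonneg h1 _)

/-- **The Cartan-coordinate reading**: at `z = tanh t · e^{iθ}` (`t > 0`),
`coeffPow p (s(z) · rot u) = cosh(t)^{-3p}` — Rühl's `cosh(η/2)^{-3p}` with `η = 2t`. -/
theorem coeffPow_cartan (p t θ : ℝ) (ht : 0 < t) (u : Circle) :
    coeffPow p (fib ((Real.tanh t : ℂ) * ((Real.cos θ : ℂ) + (Real.sin θ : ℂ) * Complex.I), u)) =
      Real.cosh t ^ (-(3 * p)) := by
  have hnorm : ‖(Real.tanh t : ℂ) * ((Real.cos θ : ℂ) + (Real.sin θ : ℂ) * Complex.I)‖ = Real.tanh t := by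
    rw [norm_mul, Complex.norm_real, Real.norm_eq_abs, abs_of_pos (T5CartanCoordinates.tanh_pos_of_pos ht),
      Complex.ofReal_cos, Complex.ofReal_sin, ← Complex.exp_mul_I, Complex.norm_exp_ofReal_mul_I, mul_one]
  have hz : (Real.tanh t : ℂ) * ((Real.cos θ : ℂ) + (Real.sin θ : ℂ) * Complex.I) ∈ ball (0 : ℂ) 1 := by
    rw [mem_ball_zero_iff, hnorm]
    exact Real.tanh_lt_one t
  rw [coeffPow_fib p hz u, hnorm]
  have h := one_sub_tanh_sq_rpow p (2 * t)
  rw [show 2 * t / 2 = t by ring, show 1 / 2 * (2 * t) = t by ring] at h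
  exact h

/-- `coeffPow 2 = coeffSq` (the real power `3` is the natural power `3`). -/
theorem coeffPow_two_eq_coeffSq : coeffPow 2 = coeffSq := by
  ext g
  unfold coeffPow coeffSq
  rw [show (3 * (2 : ℝ) / 2) = ((3 : ℕ) : ℝ) by norm_num, Real.rpow_natCast]

section main

variable [MeasurableSpace Circle] [BorelSpace Circle]

/-- `∫⁻_G coeffPow p dν = 2π / (3p - 2)` (against the explicit measure `ν`). -/
theorem lintegral_coeffPow_nu (p : ℝ) (hp : 2 / 3 < p) :
    ∫⁻ g, ENNReal.ofReal (coeffPow p g) ∂(nu haarCircle) = ENNReal.ofReal (2 * π / (3 * p - 2)) := by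
  rw [lintegral_nu haarCircle _ (continuous_coeffPow p).measurable.ennreal_ofReal]
  have h : ∀ z ∈ ball (0 : ℂ) 1,
      ENNReal.ofReal (dens z) * ∫⁻ u, ENNReal.ofReal (coeffPow p (sec z * rot u)) ∂haarCircle =
        ENNReal.ofReal ((1 - ‖z‖ ^ 2) ^ (3 * p / 2 - 2)) := by
    intro z hz
    have hin : ∀ u : Circle, coeffPow p (sec z * rot u) = (1 - ‖z‖ ^ 2) ^ (3 * p / 2) :=
      fun u => coeffPow_fib p hz u
    simp_rw [hin]
    rw [lintegral_const, haarCircle_univ, mul_one, ← ENNReal.ofReal_mul (dens_nonneg z), dens_eq_norm]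
    congr 1
    have h1 : 0 < 1 - ‖z‖ ^ 2 := by
      have := mem_ball_zero_iff.mp hz
      nlinarith [norm_nonneg z]
    rw [Real.rpow_sub h1, Real.rpow_two]
    field_simp
  rw [setLIntegral_congr_fun measurableSet_ball h, lintegral_ball_rpow p hp]

/-- **`coeffPow p` is integrable against every Haar measure of `SU(1,1)` for `p > 2/3`** — the
«`L¹ ∩ L²`» of P2′ (`p = 1`: `L¹`; `p = 2`: `L²` of the coefficient). -/
theorem integrable_coeffPow (μ : Measure SU11) [IsHaarMeasure μ] (p : ℝ) (hp : 2 / 3 < p) :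
    Integrable (coeffPow p) μ := by
  have hnu : Integrable (coeffPow p) (nu haarCircle) := by
    refine ⟨(continuous_coeffPow p).aestronglyMeasurable, ?_⟩
    show ∫⁻ g, ‖coeffPow p g‖ₑ ∂(nu haarCircle) < ∞
    simp_rw [Real.enorm_eq_ofReal (coeffPow_nonneg p _)]
    rw [lintegral_coeffPow_nu p hp]
    exact ENNReal.ofReal_lt_top
  set c := haarScalarFactor (nu haarCircle) μ with hc
  have hc0 : c ≠ 0 := (haarScalarFactor_cartan_pos μ).ne'
  have hnu' : nu haarCircle = c • μ := nu_eq_smul haarCircle μ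
  rw [hnu'] at hnu
  exact (integrable_smul_measure (ENNReal.coe_ne_zero.mpr hc0) ENNReal.coe_ne_top).mp hnu

/-- `∫_G coeffPow p dν = 2π / (3p - 2)`. -/
theorem integral_coeffPow_nu (p : ℝ) (hp : 2 / 3 < p) :
    ∫ g, coeffPow p g ∂(nu haarCircle) = 2 * π / (3 * p - 2) := by
  rw [integral_eq_lintegral_of_nonneg_ae (Filter.Eventually.of_forall (coeffPow_nonneg p))
    (continuous_coeffPow p).aestronglyMeasurable, lintegral_coeffPow_nu p hp, ENNReal.toReal_ofReal]
  have : 0 < 3 * p - 2 := by linarith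
  positivity

/-- For every Haar measure `μ` of `SU(1,1)`: `c • ∫_G coeffPow p dμ = 2π / (3p - 2)`,
`c = haarScalarFactor ν μ > 0`. -/
theorem integral_coeffPow (μ : Measure SU11) [IsHaarMeasure μ] (p : ℝ) (hp : 2 / 3 < p) :
    (haarScalarFactor (nu haarCircle) μ : ℝ) • ∫ g, coeffPow p g ∂μ = 2 * π / (3 * p - 2) := by
  set c := haarScalarFactor (nu haarCircle) μ with hc
  have hnu : nu haarCircle = c • μ := nu_eq_smul haarCircle μ
  calc (c : ℝ) • ∫ g, coeffPow p g ∂μ = ∫ g, coeffPow p g ∂(c • μ) := by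
        rw [integral_smul_nnreal_measure, NNReal.smul_def]
    _ = ∫ g, coeffPow p g ∂(nu haarCircle) := by rw [← hnu]
    _ = 2 * π / (3 * p - 2) := integral_coeffPow_nu p hp

/-- **Rühl's formula in kernel**: against `μ_R = π⁻¹ • ν`, `∫_G cosh(η/2)^{-3p} dμ_R = 2 / (3p - 2)`
for every `p > 2/3` — the printed value. -/
theorem integral_coeffPow_ruhl (p : ℝ) (hp : 2 / 3 < p) :
    ∫ g, coeffPow p g ∂ruhl = 2 / (3 * p - 2) := by
  unfold ruhl
  rw [integral_smul_measure, integral_coeffPow_nu p hp, ENNReal.toReal_ofReal (by positivity),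
    smul_eq_mul]
  have hπ : π ≠ 0 := Real.pi_ne_zero
  have h3 : (3 * p - 2) ≠ 0 := by linarith
  field_simp

/-- `p = 1`: `∫_G cosh(η/2)^{-3} dμ_R = 2` — the printed `L¹` value. -/
theorem integral_coeffPow_ruhl_one : ∫ g, coeffPow 1 g ∂ruhl = 2 := by
  rw [integral_coeffPow_ruhl 1 (by norm_num)]
  norm_num

/-- `p = 2`: `∫_G cosh(η/2)^{-6} dμ_R = 1/2` — the printed `L²` value. -/
theorem integral_coeffPow_ruhl_two : ∫ g, coeffPow 2 g ∂ruhl = 1 / 2 := by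
  rw [integral_coeffPow_ruhl 2 (by norm_num)]
  norm_num

end main

end Summit.Ventures.HodgeRepro2.T5SU11CoefficientPow
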